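import Mathlib
import Literature.Barriers.ValiantsHypothesis.AlgebraicNaturalProofs
import Literature.Computability.AlgebraicComplexity.ArithCircuitProofs
import Summits.ValiantsHypothesis.ValiantsHypothesis.Theorems.BarrierLeverPartitionMinorsHitByVPCellDoorPotentials

/-!
# Route BarrierLever — item `PartitionMinorsHitByVP` (stmt-ValiantsHypothesis-19717):
# the potential door with a UNIQUE TIGHT MATCHING (permutation-supported tight matrix)

Helper file (`--supports stmt-ValiantsHypothesis-19717`; cell valiant-natproofs, rung V4, 𝒟-side,
prover seat val-np-p6 gen 2). Definition-free, outside the theses cone. Closes NO item.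

Third combinatorial reason for `det N ≠ 0` in the potential door
(`…StrataDoor.partitionMinor_hit_of_potentials`, p474773), after block-DIAGONAL tight matrices (cell
door, p475102) and block-TRIANGULAR ones (semi-strict cell door, p478868): the tight pattern is
supported on the graph of ONE bijection `τ` of the index type (every tight triple `(i, j, t)` has
`j = τ i`) and the tight entries on that graph are nonzero. Then `N` is a generalized permutation
matrix and `det N = ± Π_i N(i, τ i) ≠ 0`. With MONOMIAL sub-witnesses this is the max-plus /
tropical certificate «unique optimal assignment» (val-np-p3's `…ProductStateSums.det_sumPow_ne_zero_of_unique_max`,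
p422118, there for sums of powers of one polynomial variable); here the sub-witnesses `F t` are
arbitrary and only their entries on the graph of `τ` matter.

* `det_ne_zero_of_perm_support` — a matrix supported on the graph of a bijection with nonzero
  entries there is nonsingular.
* **`partitionMinor_hit_of_uniqueTightMatching`** — the door (ι-indexed; size `≤ Σ_t L(F t) + m(2h+2)`,
  degree `≤ max_t deg (F t)`).

WHAT THIS IS NOT: a variant of the gluing step; nothing on which layouts admit such certificates, on
TT / item 19616 / 19761, on crux 14610 or on VP vs VNP.
-/

set_option linter.dupNamespace false

namespace Summit.ValiantsHypothesis.ValiantsHypothesis.Theorems.BarrierLever.StrataDoor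

open Finset
open Literature.Barriers.ValiantsHypothesis Literature.Computability.AlgebraicComplexity

/-- A matrix supported on the graph of a bijection `τ` (`B i j = 0` unless `j = τ i`) with nonzero
entries `B i (τ i)` is nonsingular. -/
theorem det_ne_zero_of_perm_support {ι : Type*} [Fintype ι] [DecidableEq ι] (B : Matrix ι ι ℂ)
    (τ : Equiv.Perm ι) (hoff : ∀ i j, j ≠ τ i → B i j = 0) (hdiag : ∀ i, B i (τ i) ≠ 0) :
    B.det ≠ 0 := by
  have hsub : B.submatrix id τ = Matrix.diagonal fun i => B i (τ i) := by
    ext i k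
    rw [Matrix.submatrix_apply, id, Matrix.diagonal_apply]
    by_cases hik : i = k
    · subst hik; rw [if_pos rfl]
    · rw [if_neg hik]
      exact hoff i (τ k) (fun hh => hik (τ.injective hh).symm)
  have hdet : (B.submatrix id τ).det ≠ 0 := by
    rw [hsub, Matrix.det_diagonal]
    exact Finset.prod_ne_zero_iff.mpr fun i _ => hdiag i
  rw [Matrix.det_permute'] at hdet
  intro h0
  rw [h0, mul_zero] at hdet
  exact hdet rfl

/-- **The potential door with a unique tight matching.** Rows and columns indexed by `ι`; `m`
sub-witnesses with affine scores and dominating potentials `Φ, Ψ` as in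
`…partitionMinor_hit_of_potentials`; if every tight triple `(i, j, t)` (`ρ t i + κ t j = Φ i + Ψ j`) has
`j = τ i` for ONE bijection `τ`, and for every `i` the tight entry
`Σ_{t tight at (i, τ i)} coeff_{x^{u i} y^{w (τ i)}} (F t)` is nonzero, then some `f` of size
`≤ Σ_{t<m} L(F t) + m(2h+2)` and degree `≤ max_t deg(F t)` has a nonsingular layout matrix on `(u, w)`. -/
theorem partitionMinor_hit_of_uniqueTightMatching {ι : Type*} [Fintype ι] [DecidableEq ι] (h m : ℕ)
    (u w : ι → Finset (Fin h)) (lam mu : ℕ → Fin h → ℤ) (kr kc : ℕ → ℤ) (Φ Ψ : ι → ℤ)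
    (hdom : ∀ t < m, ∀ i j : ι,
      kr t + ∑ a ∈ u i, lam t a + (kc t + ∑ c ∈ w j, mu t c) ≤ Φ i + Ψ j)
    (τ : Equiv.Perm ι)
    (htight : ∀ t < m, ∀ i j : ι,
      kr t + ∑ a ∈ u i, lam t a + (kc t + ∑ c ∈ w j, mu t c) = Φ i + Ψ j → j = τ i)
    (F : ℕ → MvPolynomial (Fin (h + h)) ℂ)
    (hdiag : ∀ i : ι, (∑ t ∈ Finset.range m,
        (if kr t + ∑ a ∈ u i, lam t a + (kc t + ∑ c ∈ w (τ i), mu t c) = Φ i + Ψ (τ i) then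
          MvPolynomial.coeff (∑ a ∈ u i, Finsupp.single (Fin.castAdd h a) 1 +
            ∑ c ∈ w (τ i), Finsupp.single (Fin.natAdd h c) 1) (F t) else 0)) ≠ 0) :
    ∃ f : MvPolynomial (Fin (h + h)) ℂ,
      f.totalDegree ≤ (Finset.range m).sup (fun t => (F t).totalDegree) ∧
      complexity f ≤ ∑ t ∈ Finset.range m, complexity (F t) + m * (h + h + 2) ∧
      (Matrix.of fun i j : ι => MvPolynomial.coeff
        (∑ a ∈ u i, Finsupp.single (Fin.castAdd h a) 1 +
          ∑ c ∈ w j, Finsupp.single (Fin.natAdd h c) 1) f).det ≠ 0 := by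
  classical
  refine partitionMinor_hit_of_potentials h m u w lam mu kr kc Φ Ψ hdom F ?_
  refine det_ne_zero_of_perm_support _ τ (fun i j hj => ?_) (fun i => ?_)
  · rw [Matrix.of_apply]
    refine Finset.sum_eq_zero fun t ht => ?_
    rw [if_neg]
    intro hh
    exact hj (htight t (Finset.mem_range.mp ht) i j hh)
  · rw [Matrix.of_apply]
    exact hdiag i

end Summit.ValiantsHypothesis.ValiantsHypothesis.Theorems.BarrierLever.StrataDoor
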